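import Mathlib
import Literature.Analysis.PDE.SingleEntropy.Averages
import Literature.Analysis.PDE.SingleEntropy.Mollify
import HarnessLib

/-!
# Oleĭnik's one-sided bound implies the entropy inequalities, I: the smooth step

Topic `Literature/Analysis/PDE/SingleEntropy`. For SMOOTH `U, F` with `Uₜ + Fₓ = 0` and
`Uₓ ≤ C` on the support of a nonnegative test function `φ`, and `f(U) ≤ F`, every `C²` convex
entropy pair `(η, q)`, `q' = f' η'`, satisfies
`∫ (η(U) φₜ + q(U) φₓ) ≥ -∫ (F - f(U)) (C η''(U) φ + η'(U) φₓ)` (`entropy_pairing_ge_smooth`):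
two integrations by parts and `η'' ≥ 0`. Applied to mollifications `U = ρ̄ ⋆ u`,
`F = ρ̄ ⋆ f(u)` of an `L^∞` solution (where `f(U) ≤ F` is Jensen, `comp_mollify_le`) this is
the regularised form of the classical implication "condition E ⇒ entropy condition"
(Dafermos, *Hyperbolic Conservation Laws in Continuum Physics*, §11.2; Hörmander 1997, §2.4);
the limit is taken in `OleinikEntropy.lean`. [folklore]
-/

noncomputable section

open MeasureTheory Set Filter Metric ContinuousLinearMap
open scoped Topology Convolution

namespace Literature.Analysis.PDE.SingleEntropy

variable (ρ : ContDiffBump (0 : ℝ × ℝ))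

/-! ## From a one-sided Lipschitz bound to all entropy inequalities (smooth step) -/

/-- Tangent-line inequality for a `C²` function with `f'' ≥ 0`. [folklore] -/
theorem tangent_line_le {f : ℝ → ℝ} (hf : ContDiff ℝ 2 f) (hfc : ∀ w, 0 ≤ deriv (deriv f) w)
    (a b : ℝ) : f a + deriv f a * (b - a) ≤ f b := by
  have h := sq_le_sub_mul_deriv_sub_of_le_deriv_deriv hf hfc a b
  nlinarith [h]

/-- **Jensen for mollification.** For `C²` convex `f`, `f (ρ̄ ⋆ u) ≤ ρ̄ ⋆ (f ∘ u)` pointwise.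
[folklore] -/
theorem comp_mollify_le {f : ℝ → ℝ} (hf : ContDiff ℝ 2 f) (hfc : ∀ w, 0 ≤ deriv (deriv f) w)
    {u : ℝ × ℝ → ℝ} (hu : Measurable u) {M : ℝ} (huM : ∀ p, |u p| ≤ M) (p : ℝ × ℝ) :
    f ((ρ.normed volume ⋆[lsmul ℝ ℝ, volume] u) p)
      ≤ (ρ.normed volume ⋆[lsmul ℝ ℝ, volume] (fun z => f (u z))) p := by
  rw [mollify_apply, mollify_apply]
  set m := ∫ z, ρ.normed volume (p - z) * u z with hm
  have hk : Continuous fun z => ρ.normed volume (p - z) := (contDiff_reflect ρ p).continuous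
  have hkc := hasCompactSupport_reflect ρ p
  obtain ⟨M', hM'⟩ := exists_abs_comp_le huM hf.continuous
  have i1 : Integrable (fun z => ρ.normed volume (p - z) * u z) volume :=
    integrable_mul_of_abs_le hu huM hk hkc
  have i2 : Integrable (fun z => ρ.normed volume (p - z) * f (u z)) volume :=
    integrable_mul_of_abs_le (hf.continuous.measurable.comp hu) hM' hk hkc
  have i0 : Integrable (fun z => ρ.normed volume (p - z)) volume :=
    (ρ.integrable_normed (μ := volume)).comp_sub_left p
  have h1 : ∫ z, ρ.normed volume (p - z) = (1 : ℝ) := by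
    rw [integral_sub_left_eq_self (fun z => ρ.normed volume z) volume p]
    exact ρ.integral_normed
  have hexp : (fun z => ρ.normed volume (p - z) * (f m + deriv f m * (u z - m)))
      = fun z => (f m - deriv f m * m) * ρ.normed volume (p - z)
          + deriv f m * (ρ.normed volume (p - z) * u z) := by
    funext z; ring
  have i3 : Integrable (fun z => ρ.normed volume (p - z) * (f m + deriv f m * (u z - m))) volume := by
    rw [hexp]; exact (i0.const_mul _).add (i1.const_mul _)
  have key : ∫ z, ρ.normed volume (p - z) * (f m + deriv f m * (u z - m))
      ≤ ∫ z, ρ.normed volume (p - z) * f (u z) :=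
    integral_mono i3 i2 fun z =>
      mul_le_mul_of_nonneg_left (tangent_line_le hf hfc m (u z)) (ρ.nonneg_normed _)
  have lhs : ∫ z, ρ.normed volume (p - z) * (f m + deriv f m * (u z - m)) = f m := by
    rw [hexp, integral_add (i0.const_mul _) (i1.const_mul _), integral_const_mul,
      integral_const_mul, h1, ← hm]
    ring
  linarith

/-- Integration by parts on the plane, the compactly supported factor on the right. [folklore] -/
theorem ibp_right {A B : ℝ × ℝ → ℝ} (hA : ContDiff ℝ 1 A) (hB : ContDiff ℝ 1 B)
    (hBc : HasCompactSupport B) (v : ℝ × ℝ) :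
    ∫ x, A x * fderiv ℝ B x v = -∫ x, fderiv ℝ A x v * B x := by
  have hA' : Continuous fun x => fderiv ℝ A x v :=
    (hA.continuous_fderiv one_ne_zero).clm_apply continuous_const
  have hB' : Continuous fun x => fderiv ℝ B x v :=
    (hB.continuous_fderiv one_ne_zero).clm_apply continuous_const
  apply integral_mul_fderiv_eq_neg_fderiv_mul_of_integrable
  · exact (hA'.mul hB.continuous).integrable_of_hasCompactSupport
      (hBc.mono (fun x hx => by intro h0; exact hx (by simp [h0])))
  · exact (hA.continuous.mul hB').integrable_of_hasCompactSupport
      ((hBc.fderiv_apply ℝ v).mono (fun x hx => by intro h0; exact hx (by simp [h0])))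
  · exact (hA.continuous.mul hB.continuous).integrable_of_hasCompactSupport
      (hBc.mono (fun x hx => by intro h0; exact hx (by simp [h0])))
  · exact fun x _ => hA.differentiable one_ne_zero x
  · exact fun x _ => hB.differentiable one_ne_zero x

/-- Integration by parts on the plane, the compactly supported factor on the left. [folklore] -/
theorem ibp_left {A B : ℝ × ℝ → ℝ} (hA : ContDiff ℝ 1 A) (hAc : HasCompactSupport A)
    (hB : ContDiff ℝ 1 B) (v : ℝ × ℝ) :
    ∫ x, A x * fderiv ℝ B x v = -∫ x, fderiv ℝ A x v * B x := by
  have hA' : Continuous fun x => fderiv ℝ A x v :=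
    (hA.continuous_fderiv one_ne_zero).clm_apply continuous_const
  have hB' : Continuous fun x => fderiv ℝ B x v :=
    (hB.continuous_fderiv one_ne_zero).clm_apply continuous_const
  apply integral_mul_fderiv_eq_neg_fderiv_mul_of_integrable
  · exact (hA'.mul hB.continuous).integrable_of_hasCompactSupport
      ((hAc.fderiv_apply ℝ v).mono (fun x hx => by intro h0; exact hx (by simp [h0])))
  · exact (hA.continuous.mul hB').integrable_of_hasCompactSupport
      (hAc.mono (fun x hx => by intro h0; exact hx (by simp [h0])))
  · exact (hA.continuous.mul hB.continuous).integrable_of_hasCompactSupport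
      (hAc.mono (fun x hx => by intro h0; exact hx (by simp [h0])))
  · exact fun x _ => hA.differentiable one_ne_zero x
  · exact fun x _ => hB.differentiable one_ne_zero x

/-- Chain rule for a scalar outer function, applied to a direction. [folklore] -/
theorem fderiv_scomp_apply {η : ℝ → ℝ} (hη : Differentiable ℝ η) {g : ℝ × ℝ → ℝ}
    (hg : Differentiable ℝ g) (p v : ℝ × ℝ) :
    fderiv ℝ (fun z => η (g z)) p v = deriv η (g p) * fderiv ℝ g p v := by
  have h := (hη (g p)).hasDerivAt.comp_hasFDerivAt p (hg p).hasFDerivAt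
  have h' : HasFDerivAt (fun z => η (g z)) (deriv η (g p) • fderiv ℝ g p) p := h
  rw [h'.fderiv]
  simp [smul_eq_mul]

/-- **Oleinik ⇒ entropy, smooth step.** For smooth `U, F` with `Uₜ + Fₓ = 0` and `Uₓ ≤ C` on the
support of a nonnegative test function `φ`, and `f(U) ≤ F` everywhere, every `C²` convex entropy
pair `(η, q)` satisfies `∫ (η(U) φₜ + q(U) φₓ) ≥ -∫ (F - f(U)) (C η''(U) φ + η'(U) φₓ)`.
(Two integrations by parts and `η'' ≥ 0`.) [folklore] -/
theorem entropy_pairing_ge_smooth {f η q : ℝ → ℝ} (hf : ContDiff ℝ 2 f) (hη : ContDiff ℝ 2 η)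
    (hηc : ∀ w, 0 ≤ deriv (deriv η) w) (hq : ∀ w, HasDerivAt q (deriv f w * deriv η w) w)
    {U F φ : ℝ × ℝ → ℝ} (hU : ContDiff ℝ 2 U) (hF : ContDiff ℝ 2 F)
    (hφ : ContDiff ℝ (⊤ : ℕ∞) φ) (hφc : HasCompactSupport φ) (hφ0 : ∀ p, 0 ≤ φ p) {C : ℝ}
    (heq : ∀ p ∈ tsupport φ, fderiv ℝ U p (1, 0) + fderiv ℝ F p (0, 1) = 0)
    (hol : ∀ p ∈ tsupport φ, fderiv ℝ U p (0, 1) ≤ C) (hJ : ∀ p, f (U p) ≤ F p) :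
    -(∫ p, (F p - f (U p))
        * (C * deriv (deriv η) (U p) * φ p + deriv η (U p) * fderiv ℝ φ p (0, 1)))
      ≤ ∫ p, (η (U p) * fderiv ℝ φ p (1, 0) + q (U p) * fderiv ℝ φ p (0, 1)) := by
  -- regularity facts
  have hf1 : Differentiable ℝ f := hf.differentiable (by norm_num)
  have hη1 : Differentiable ℝ η := hη.differentiable (by norm_num)
  have hη' : ContDiff ℝ 1 (deriv η) := hη.iterate_deriv' 1 1
  have hη2 : Differentiable ℝ (deriv η) := hη'.differentiable one_ne_zero
  have hqd : Differentiable ℝ q := fun w => (hq w).differentiableAt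
  have hqd' : ∀ w, deriv q w = deriv f w * deriv η w := fun w => (hq w).deriv
  have hq1 : ContDiff ℝ 1 q := by
    rw [contDiff_one_iff_deriv]
    refine ⟨hqd, ?_⟩
    have : deriv q = fun w => deriv f w * deriv η w := funext hqd'
    rw [this]
    exact (hf.continuous_deriv (by norm_num)).mul (hη.continuous_deriv (by norm_num))
  have hU1 : Differentiable ℝ U := hU.differentiable (by norm_num)
  have hF1 : Differentiable ℝ F := hF.differentiable (by norm_num)
  have hφ1 : Differentiable ℝ φ := hφ.differentiable (by simp)
  have hφC1 : ContDiff ℝ 1 φ := hφ.of_le (by simp)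
  have hηU : ContDiff ℝ 1 (fun p => η (U p)) := (hη.of_le (by norm_num)).comp (hU.of_le (by norm_num))
  have hqU : ContDiff ℝ 1 (fun p => q (U p)) := hq1.comp (hU.of_le (by norm_num))
  have hη'U : ContDiff ℝ 1 (fun p => deriv η (U p)) := hη'.comp (hU.of_le (by norm_num))
  have hfU : ContDiff ℝ 1 (fun p => f (U p)) := (hf.of_le (by norm_num)).comp (hU.of_le (by norm_num))
  have hG : ContDiff ℝ 1 (fun p => F p - f (U p)) := (hF.of_le (by norm_num)).sub hfU
  -- continuity of the pieces
  have cφt : Continuous fun p => fderiv ℝ φ p (1, 0) :=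
    (hφC1.continuous_fderiv one_ne_zero).clm_apply continuous_const
  have cφx : Continuous fun p => fderiv ℝ φ p (0, 1) :=
    (hφC1.continuous_fderiv one_ne_zero).clm_apply continuous_const
  have cUt : Continuous fun p => fderiv ℝ U p (1, 0) :=
    ((hU.of_le (by norm_num) : ContDiff ℝ 1 U).continuous_fderiv one_ne_zero).clm_apply
      continuous_const
  have cUx : Continuous fun p => fderiv ℝ U p (0, 1) :=
    ((hU.of_le (by norm_num) : ContDiff ℝ 1 U).continuous_fderiv one_ne_zero).clm_apply
      continuous_const
  have cGx : Continuous fun p => fderiv ℝ (fun p => F p - f (U p)) p (0, 1) :=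
    (hG.continuous_fderiv one_ne_zero).clm_apply continuous_const
  have cηU : Continuous fun p => η (U p) := hη.continuous.comp hU.continuous
  have cη'U : Continuous fun p => deriv η (U p) := hη'.continuous.comp hU.continuous
  have cη''U : Continuous fun p => deriv (deriv η) (U p) :=
    (hη'.continuous_deriv le_rfl).comp hU.continuous
  have cqU : Continuous fun p => q (U p) := hq1.continuous.comp hU.continuous
  have cfU : Continuous fun p => f (U p) := hf.continuous.comp hU.continuous
  have cf'U : Continuous fun p => deriv f (U p) := (hf.continuous_deriv (by norm_num)).comp hU.continuous
  have cG : Continuous fun p => F p - f (U p) := hF.continuous.sub cfU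
  -- compact supports generated by φ and φₓ
  have hφxc : HasCompactSupport fun p => fderiv ℝ φ p (0, 1) := hφc.fderiv_apply ℝ (0, 1)
  have hφtc : HasCompactSupport fun p => fderiv ℝ φ p (1, 0) := hφc.fderiv_apply ℝ (1, 0)
  -- Step (i): split
  have iA : Integrable (fun p => η (U p) * fderiv ℝ φ p (1, 0)) volume :=
    (cηU.mul cφt).integrable_of_hasCompactSupport
      (hφtc.mono (fun x hx => by intro h0; exact hx (by simp [h0])))
  have iB : Integrable (fun p => q (U p) * fderiv ℝ φ p (0, 1)) volume :=
    (cqU.mul cφx).integrable_of_hasCompactSupport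
      (hφxc.mono (fun x hx => by intro h0; exact hx (by simp [h0])))
  rw [integral_add iA iB]
  -- Step (ii): integrate by parts
  rw [ibp_right hηU hφC1 hφc (1, 0), ibp_right hqU hφC1 hφc (0, 1)]
  simp_rw [fderiv_scomp_apply hη1 hU1, fderiv_scomp_apply hqd hU1, hqd']
  -- Step (iii): pointwise substitution of the equation
  have i3 : Integrable (fun p => deriv η (U p) * fderiv ℝ U p (1, 0) * φ p) volume :=
    ((cη'U.mul cUt).mul hφ.continuous).integrable_of_hasCompactSupport
      (hφc.mono (fun x hx => by intro h0; exact hx (by simp [h0])))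
  have i4 : Integrable (fun p => deriv f (U p) * deriv η (U p) * fderiv ℝ U p (0, 1) * φ p)
      volume :=
    (((cf'U.mul cη'U).mul cUx).mul hφ.continuous).integrable_of_hasCompactSupport
      (hφc.mono (fun x hx => by intro h0; exact hx (by simp [h0])))
  have hGx : ∀ p, fderiv ℝ (fun p => F p - f (U p)) p (0, 1)
      = fderiv ℝ F p (0, 1) - deriv f (U p) * fderiv ℝ U p (0, 1) := by
    intro p
    have hd : DifferentiableAt ℝ (fun p => f (U p)) p := (hf1 (U p)).comp p (hU1 p)
    rw [fderiv_fun_sub (hF1 p) hd, _root_.sub_apply, fderiv_scomp_apply hf1 hU1]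
  have hz : ∀ p ∉ tsupport φ, φ p = 0 ∧ fderiv ℝ φ p (0, 1) = 0 := fun p hp =>
    ⟨image_eq_zero_of_notMem_tsupport hp, by simp [fderiv_of_notMem_tsupport ℝ hp]⟩
  -- Step (iii)
  have e1 : (∫ p, deriv η (U p) * fderiv ℝ U p (1, 0) * φ p)
      + (∫ p, deriv f (U p) * deriv η (U p) * fderiv ℝ U p (0, 1) * φ p)
      = -∫ p, (deriv η (U p) * φ p) * fderiv ℝ (fun p => F p - f (U p)) p (0, 1) := by
    rw [← integral_add i3 i4, ← integral_neg]
    congr 1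
    funext p
    rw [hGx p]
    by_cases hp : p ∈ tsupport φ
    · have hUt : fderiv ℝ U p (1, 0) = -(fderiv ℝ F p (0, 1)) := by linarith [heq p hp]
      rw [hUt]
      ring
    · simp [(hz p hp).1]
  -- Step (iv)
  have hA : ContDiff ℝ 1 (fun p => deriv η (U p) * φ p) := hη'U.mul hφC1
  have hAc : HasCompactSupport (fun p => deriv η (U p) * φ p) :=
    hφc.mono (fun x hx => by intro h0; exact hx (by simp [h0]))
  have e2 := ibp_left hA hAc hG (0, 1)
  have hAx : ∀ p, fderiv ℝ (fun p => deriv η (U p) * φ p) p (0, 1)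
      = deriv η (U p) * fderiv ℝ φ p (0, 1)
        + φ p * (deriv (deriv η) (U p) * fderiv ℝ U p (0, 1)) := by
    intro p
    have hd1 : DifferentiableAt ℝ (fun p => deriv η (U p)) p := (hη2 (U p)).comp p (hU1 p)
    rw [fderiv_fun_mul hd1 (hφ1 p), _root_.add_apply,
      _root_.smul_apply, _root_.smul_apply,
      fderiv_scomp_apply hη2 hU1]
    simp [smul_eq_mul]
  simp_rw [hAx] at e2
  -- Step (v)
  have hGc' : ∀ p, p ∉ tsupport φ →
      (F p - f (U p)) * (C * deriv (deriv η) (U p) * φ p + deriv η (U p) * fderiv ℝ φ p (0, 1))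
        = 0 := fun p hp => by simp [(hz p hp).1, (hz p hp).2]
  have i5 : Integrable (fun p => (F p - f (U p))
      * (C * deriv (deriv η) (U p) * φ p + deriv η (U p) * fderiv ℝ φ p (0, 1))) volume :=
    (cG.mul (((continuous_const.mul cη''U).mul hφ.continuous).add (cη'U.mul cφx)))
      |>.integrable_of_hasCompactSupport
      (HasCompactSupport.of_support_subset_isCompact hφc (fun p hp => by
        by_contra h
        exact hp (hGc' p h)))
  have i6 : Integrable (fun p => (deriv η (U p) * fderiv ℝ φ p (0, 1)
      + φ p * (deriv (deriv η) (U p) * fderiv ℝ U p (0, 1))) * (F p - f (U p))) volume :=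
    ((((cη'U.mul cφx).add (hφ.continuous.mul (cη''U.mul cUx))).mul cG))
      |>.integrable_of_hasCompactSupport
      (HasCompactSupport.of_support_subset_isCompact hφc (fun p hp => by
        by_contra h
        exact hp (by simp [(hz p h).1, (hz p h).2])))
  have hmono : ∫ p, (deriv η (U p) * fderiv ℝ φ p (0, 1)
      + φ p * (deriv (deriv η) (U p) * fderiv ℝ U p (0, 1))) * (F p - f (U p))
      ≤ ∫ p, (F p - f (U p))
        * (C * deriv (deriv η) (U p) * φ p + deriv η (U p) * fderiv ℝ φ p (0, 1)) := by
    apply integral_mono i6 i5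
    intro p
    by_cases hp : p ∈ tsupport φ
    · have hG0 : 0 ≤ F p - f (U p) := sub_nonneg.mpr (hJ p)
      have h1 : φ p * (deriv (deriv η) (U p) * fderiv ℝ U p (0, 1))
          ≤ φ p * (deriv (deriv η) (U p) * C) :=
        mul_le_mul_of_nonneg_left (mul_le_mul_of_nonneg_left (hol p hp) (hηc _)) (hφ0 p)
      have h2 := mul_le_mul_of_nonneg_right
        (add_le_add_left h1 (deriv η (U p) * fderiv ℝ φ p (0, 1))) hG0
      dsimp only
      nlinarith [h2]
    · dsimp only
      rw [hGc' p hp]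
      simp [(hz p hp).1, (hz p hp).2]
  linarith [e1, e2, hmono]


end Literature.Analysis.PDE.SingleEntropy
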